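import Summits.Schanuel.Schanuel.Theorems.ZilberEacSuperellipticFibreCurves
import HarnessLib

/-!
# Arbitrary base branches, XLII: fibre curves whose branches at infinity are all POLES — the
# `y₀`-reflected relation `F^*(x₀, w) = w^r F(x₀, 1/w)` and its zero branch

HONEST FRAMING.  Cell `pub-schanuel` (Zilber's Exponential-Algebraic Closedness, case ladder;
host summit Schanuel), seat 2, gen 29.  Files XXXVIII–XXXIX need a root `θ` of the top `x₀`-row `T`
of the fibre relation `F(x₀, y₀) = 0`, i.e. a branch at `x₀ = ∞` with a FINITE value.  When the
leading `y₀`-coefficient `F_r` does not reach the top degree `N` (so `T(0)`-free part… precisely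
`[x₀^N]F_r = 0`), the reflected relation `F^* = reflect_r F` (`F^*(x₀, w) = w^r F(x₀, 1/w)`,
**`irreducible_reflect_natDegree`**, `reflect_reflect`) has top row with the root `w = 0`:
Newton–Puiseux gives `w = t^j g(t)`, i.e. a POLE branch `y₀ = g(t)^{-1}t^{-j}` of `F`
(**`exists_poleCycle_puiseux`**), and the pole route of files XXXII–XXXVIII applies on every sheet:
**`unprojectedDense_superelliptic_fibreCurve_poleRow`** — `1 ≤ k`, `P` monic of degree `M ≥ 1`
with `M ≠ k ∨ k ≥ 3`, `F` irreducible of positive `y₀`-degree with `F(x₀, 0) ≢ 0`, rows of degree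
`≤ N`, some row of degree `N` and `deg F_r < N` ⟹ every irreducible `S ⊇` cylinder over
`C ×_{x₀} F` is dense (no direction, residue or circle condition: a pole fibre value has none).
Together with XXXVIII (`k ≥ 3`): over `x₁^k = P(x₀)`, `k ≥ 3`, EVERY irreducible fibre
relation `F(x₀, y₀)` of positive `y₀`-degree with `F(x₀, 0) ≢ 0` gives density (a top-row root, or
else all poles).  Decided instances of an OPEN question (Mantova–Masser, PLMS 2024 §1 p. 5); EC(3,2)
OPEN; NOT Schanuel's conjecture (neither used nor implied); EAC ⇏ SC.
-/

noncomputable section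

open Filter Topology Set Complex Polynomial
open Literature.NumberTheory.Transcendental Literature.ModelTheory.Zilber
open Literature.ModelTheory.ExponentialFields

set_option linter.dupNamespace false

namespace Summit.Schanuel.Schanuel.Theorems

/-! ## Part A. Reflection in the fibre variable -/

/-- `reflect N` is an involution. [folklore] -/
theorem reflect_reflect {R : Type*} [Semiring R] (N : ℕ) (f : R[X]) :
    (f.reflect N).reflect N = f := by
  ext i
  rw [Polynomial.coeff_reflect, Polynomial.coeff_reflect, Polynomial.revAt_invol]

/-- **The `y₀`-reflection of an irreducible fibre relation is irreducible**: `F ∈ ℂ[x₀][y₀]`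
irreducible of `y₀`-degree `r ≥ 1` with `F(x₀, 0) ≢ 0` ⟹ `reflect_r F` irreducible. [folklore] -/
theorem irreducible_reflect_natDegree (F : Polynomial (Polynomial ℂ)) (hFirr : Irreducible F)
    (hF1 : F.natDegree ≠ 0) (hF00 : F.coeff 0 ≠ 0) :
    Irreducible (F.reflect F.natDegree) := by
  set r := F.natDegree with hr
  set G := F.reflect r with hG
  have hF0 : F ≠ 0 := hFirr.ne_zero
  have hGr : G.coeff r = F.coeff 0 := by
    rw [hG, Polynomial.coeff_reflect, Polynomial.revAt_le le_rfl, Nat.sub_self]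
  have hG0 : G.coeff 0 = F.coeff r := by
    rw [hG, Polynomial.coeff_reflect, Polynomial.revAt_le (Nat.zero_le _), Nat.sub_zero]
  have hGne : G ≠ 0 := by
    intro h
    apply hF00
    rw [← hGr, h, Polynomial.coeff_zero]
  have hGdeg : G.natDegree = r := by
    refine le_antisymm (Polynomial.natDegree_reflect_le.trans (by rw [hr, max_self])) ?_
    exact Polynomial.le_natDegree_of_ne_zero (by rw [hGr]; exact hF00)
  have hG00 : G.coeff 0 ≠ 0 := by
    rw [hG0, hr]
    exact Polynomial.leadingCoeff_ne_zero.2 hF0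
  refine ⟨fun hu => hF1 (by rw [← hGdeg]; exact Polynomial.natDegree_eq_zero_of_isUnit hu), ?_⟩
  intro a b hab
  have ha0 : a ≠ 0 := by rintro rfl; exact hGne (by rw [hab, zero_mul])
  have hb0 : b ≠ 0 := by rintro rfl; exact hGne (by rw [hab, mul_zero])
  have hdeg : a.natDegree + b.natDegree = r := by
    rw [← hGdeg, hab, Polynomial.natDegree_mul ha0 hb0]
  have hFab : F = a.reflect a.natDegree * b.reflect b.natDegree := by
    rw [← Polynomial.reflect_mul a b le_rfl le_rfl, hdeg, ← hab, hG, reflect_reflect]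
  -- a factor whose reflection is a unit is itself a unit (since `G(x₀, 0) ≠ 0`)
  have key : ∀ {a b : Polynomial (Polynomial ℂ)}, G = a * b →
      IsUnit (a.reflect a.natDegree) → IsUnit a := by
    intro a b hab hu
    obtain ⟨u, hu, hua⟩ := Polynomial.isUnit_iff.1 hu
    have ha : a = Polynomial.C u * Polynomial.X ^ a.natDegree := by
      have h1 : (a.reflect a.natDegree).reflect a.natDegree =
          (Polynomial.C u).reflect a.natDegree := by rw [hua]
      rw [reflect_reflect, Polynomial.reflect_C] at h1
      exact h1
    rcases Nat.eq_zero_or_pos a.natDegree with hA | hA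
    · rw [ha, hA, pow_zero, mul_one]
      exact Polynomial.isUnit_C.2 hu
    · exfalso
      apply hG00
      rw [hab, ha, mul_comm (Polynomial.C u), mul_assoc, Polynomial.coeff_X_pow_mul',
        if_neg (by omega)]
  rcases hFirr.isUnit_or_isUnit hFab with hu | hu
  · exact Or.inl (key hab hu)
  · exact Or.inr (key (by rw [hab, mul_comm]) hu)

/-- Evaluation of the reflection: for `w ≠ 0`, `F^*(x₀)(w) = 0 ↔ F(x₀)(w⁻¹) = 0`. [folklore] -/
theorem eval_reflect_eq_zero_iff (F : Polynomial (Polynomial ℂ)) (x₀ : ℂ) {w : ℂ} (hw : w ≠ 0) :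
    ((F.reflect F.natDegree).map (Polynomial.evalRingHom x₀)).eval w = 0 ↔
      (F.map (Polynomial.evalRingHom x₀)).eval w⁻¹ = 0 := by
  haveI : Invertible w⁻¹ := invertibleOfNonzero (inv_ne_zero hw)
  have h := Polynomial.eval₂_reflect_eq_zero_iff (RingHom.id ℂ) w⁻¹ F.natDegree
    (F.map (Polynomial.evalRingHom x₀)) (Polynomial.natDegree_map_le)
  rw [invOf_eq_inv, inv_inv, Polynomial.reflect_map] at h
  simpa only [Polynomial.eval₂_id] using h

/-! ## Part B. A pole branch at infinity -/

/-- **Puiseux at infinity, pole branch.**  `F ∈ ℂ[x₀][y₀]` irreducible of `y₀`-degree `r ≥ 1` with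
`F(x₀, 0) ≢ 0`, rows of degree `≤ N`, some row of degree exactly `N`, and `deg F_r < N`.  Then
there are `e ≥ 1`, `j ≥ 1` and `η` analytic at `0` with `η(0) ≠ 0` such that
`F(t^{-e}, η(t)t^{-j}) = 0` for small `t ≠ 0`. [folklore (Newton–Puiseux)] (new in this form) -/
theorem exists_poleCycle_puiseux (F : Polynomial (Polynomial ℂ)) (hFirr : Irreducible F)
    (hF1 : F.natDegree ≠ 0) (hF00 : F.coeff 0 ≠ 0) (N : ℕ) (hN : ∀ j, (F.coeff j).natDegree ≤ N)
    (hsome : ∃ j, (F.coeff j).coeff N ≠ 0) (htop : (F.coeff F.natDegree).coeff N = 0) :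
    ∃ (e j : ℕ) (η : ℂ → ℂ), 1 ≤ e ∧ 1 ≤ j ∧ AnalyticAt ℂ η 0 ∧ η 0 ≠ 0 ∧
      ∀ᶠ t in 𝓝[≠] (0 : ℂ),
        (F.map (Polynomial.evalRingHom (t ^ e)⁻¹)).eval (η t * t ^ (-(j : ℤ))) = 0 := by
  classical
  set r := F.natDegree with hr
  set G := F.reflect r with hG
  have hGirr : Irreducible G := irreducible_reflect_natDegree F hFirr hF1 hF00
  have hGcoeff : ∀ i, G.coeff i = F.coeff (Polynomial.revAt r i) := fun i => by
    rw [hG, Polynomial.coeff_reflect]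
  have hGdeg : G.natDegree = r := by
    refine le_antisymm (Polynomial.natDegree_reflect_le.trans (by rw [hr, max_self])) ?_
    refine Polynomial.le_natDegree_of_ne_zero ?_
    rw [hGcoeff, Polynomial.revAt_le le_rfl, Nat.sub_self]
    exact hF00
  have hG1 : G.natDegree ≠ 0 := by rw [hGdeg]; exact hF1
  have hG00 : G.coeff 0 ≠ 0 := by
    rw [hGcoeff, Polynomial.revAt_le (Nat.zero_le _), Nat.sub_zero, hr]
    exact Polynomial.leadingCoeff_ne_zero.2 hFirr.ne_zero
  have hGN : ∀ i, (G.coeff i).natDegree ≤ N := fun i => by rw [hGcoeff]; exact hN _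
  -- the top row of `G`
  set T : Polynomial ℂ := ∑ i ∈ Finset.range (r + 1), Polynomial.monomial i ((G.coeff i).coeff N)
    with hT
  have hTcoeff : ∀ i, T.coeff i = (G.coeff i).coeff N := by
    intro i
    rw [hT, Polynomial.finsetSum_coeff]
    simp only [Polynomial.coeff_monomial]
    rw [Finset.sum_ite_eq']
    by_cases hi : i ∈ Finset.range (r + 1)
    · rw [if_pos hi]
    · rw [if_neg hi]
      have : G.coeff i = 0 := Polynomial.coeff_eq_zero_of_natDegree_lt (by
        rw [hGdeg]; rw [Finset.mem_range] at hi; omega)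
      rw [this, Polynomial.coeff_zero]
  have hT0 : T ≠ 0 := by
    obtain ⟨j, hj⟩ := hsome
    have hjr : j ≤ r := by
      by_contra h
      push Not at h
      have : F.coeff j = 0 := Polynomial.coeff_eq_zero_of_natDegree_lt (by rw [← hr]; exact h)
      rw [this, Polynomial.coeff_zero] at hj
      exact hj rfl
    intro hT0
    have h := hTcoeff (Polynomial.revAt r j)
    rw [hT0, Polynomial.coeff_zero, hGcoeff, Polynomial.revAt_invol] at h
    exact hj h.symm
  have hTroot : T.IsRoot 0 := by
    rw [Polynomial.IsRoot, ← Polynomial.coeff_zero_eq_eval_zero, hTcoeff, hGcoeff,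
      Polynomial.revAt_le (Nat.zero_le _), Nat.sub_zero, hr]
    exact htop
  -- the zero branch of `G` at infinity
  obtain ⟨e, ψ, he, hψan, hψ0, hbranch⟩ := exists_fibreCycle_puiseux G hGirr hG1 N hGN T hTcoeff hT0 hTroot
  have hne := fibreCycle_not_eventually_zero G hG00 he hbranch
  obtain ⟨j, g, hgan, hg0, hψg⟩ := (hψan.exists_eventuallyEq_pow_smul_nonzero_iff).2 hne
  have hj : 1 ≤ j := by
    rcases Nat.eq_zero_or_pos j with rfl | hj
    · exfalso
      have h := hψg.self_of_nhds
      rw [pow_zero, one_smul, hψ0] at h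
      exact hg0 h.symm
    · exact hj
  have hgne : ∀ᶠ t in 𝓝 (0 : ℂ), g t ≠ 0 := hgan.continuousAt.eventually_ne hg0
  refine ⟨e, j, fun t => (g t)⁻¹, he, hj, hgan.inv hg0, inv_ne_zero hg0, ?_⟩
  filter_upwards [hbranch, nhdsWithin_le_nhds hψg, nhdsWithin_le_nhds hgne, self_mem_nhdsWithin]
    with t hb hψt hgt (ht0 : t ≠ 0)
  have hψne : ψ t ≠ 0 := by
    rw [hψt, sub_zero, smul_eq_mul]
    exact mul_ne_zero (pow_ne_zero _ ht0) hgt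
  have h := (eval_reflect_eq_zero_iff F ((t ^ e)⁻¹) hψne).1 (by rw [← hG]; exact hb)
  have heq : (g t)⁻¹ * t ^ (-(j : ℤ)) = (ψ t)⁻¹ := by
    rw [hψt, sub_zero, smul_eq_mul, zpow_neg, zpow_natCast, mul_inv, mul_comm]
  rw [heq]
  exact h

/-! ## Part C. Density: fibre curves with only poles at infinity -/

section Superelliptic

variable (P : Polynomial ℂ)

/-- **Fibre curves with an all-pole top row over `x₁^k = P(x₀)`.**  `S` irreducible closed of
dimension `≤ 2` containing every `(x₀, x₁, y₀, e^{x₁})` with `x₁^k = P(x₀)`, `F(x₀, y₀) = 0`; `P`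
monic of degree `M ≥ 1`, `1 ≤ k`, `M ≠ k ∨ k ≥ 3`; `F` irreducible of positive `y₀`-degree with
`F(x₀, 0) ≢ 0`, rows of degree `≤ N`, some row of degree `N`, and `deg F_r < N` (`F_r` the leading
`y₀`-coefficient).  Then `S` has Zariski-dense exponential points. [cite: MantovaMasser2023, §1
Further remarks, p. 5 (the question, open in general)] (new) -/
theorem unprojectedDense_superelliptic_fibreCurve_poleRow {S : Set (Fin 2 ⊕ Fin 2 → ℂ)}
    (hS : IsIrreducibleClosed ℂ S) (hdim : zariskiDim ℂ S ≤ (2 : ℕ)) {k : ℕ} (hk : 1 ≤ k)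
    (hP : P.Monic) (hM : 1 ≤ P.natDegree) (hexc : P.natDegree ≠ k ∨ 3 ≤ k)
    (F : Polynomial (Polynomial ℂ)) (hFirr : Irreducible F) (hF1 : F.natDegree ≠ 0)
    (hF00 : F.coeff 0 ≠ 0) (N : ℕ) (hN : ∀ j, (F.coeff j).natDegree ≤ N)
    (hsome : ∃ j, (F.coeff j).coeff N ≠ 0) (htop : (F.coeff F.natDegree).coeff N = 0)
    (hsub : ∀ x₀ x₁ y₀ : ℂ, x₁ ^ k - P.eval x₀ = 0 →
      (F.map (Polynomial.evalRingHom x₀)).eval y₀ = 0 →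
      (Sum.elim ![x₀, x₁] ![y₀, Complex.exp x₁] : Fin 2 ⊕ Fin 2 → ℂ) ∈ S) :
    UnprojectedDense S := by
  have hk0 : k ≠ 0 := by omega
  obtain ⟨e, j, η, he, hj, hηan, hη0, hbranch⟩ :=
    exists_poleCycle_puiseux F hFirr hF1 hF00 N hN hsome htop
  have hηk : AnalyticAt ℂ (fun σ : ℂ => η (σ ^ k)) 0 :=
    hηan.comp_of_eq (analyticAt_id.pow k) (by simp [zero_pow hk0])
  have hbranchk : ∀ᶠ σ in 𝓝[≠] (0 : ℂ),
      (F.map (Polynomial.evalRingHom (σ ^ (e * k))⁻¹)).eval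
        (η (σ ^ k) * σ ^ (-((k * j : ℕ) : ℤ))) = 0 := by
    filter_upwards [(tendsto_pow_punctured_nhds_zero hk).eventually hbranch] with σ hσ
    rw [mul_comm e k, pow_mul]
    have e1 : σ ^ (-((k * j : ℕ) : ℤ)) = (σ ^ k) ^ (-(j : ℤ)) := by
      rw [zpow_neg, zpow_neg, zpow_natCast, zpow_natCast, pow_mul]
    rw [e1]
    exact hσ
  refine unprojectedDense_superelliptic_sheets_pole_ram P hS hdim hk hP hM hexc ?_
  intro ζ Φ hζ hΦan hΦ0 _ hsheet
  refine ⟨e, fun σ => η (σ ^ k), -((k * j : ℕ) : ℤ), he, hηk, by simpa [zero_pow hk0] using hη0,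
    ?_, ?_⟩
  · rw [neg_ne_zero, Nat.cast_ne_zero]
    exact Nat.mul_ne_zero hk0 (by omega)
  · filter_upwards [(tendsto_pow_punctured_nhds_zero he).eventually hsheet, hbranchk] with σ hs hb
    have h := hsub ((σ ^ (e * k))⁻¹) (Φ (σ ^ e) * (σ ^ (e * P.natDegree))⁻¹)
      (η (σ ^ k) * σ ^ (-((k * j : ℕ) : ℤ))) (by rw [pow_mul, pow_mul]; exact hs) hb
    simpa using h

/-- **All fibre curves over the cyclic covers, `k ≥ 3`**: `F` irreducible of positive `y₀`-degree
with `F(x₀, 0) ≢ 0` and rows of degree `≤ N`, some of degree `N` — whether or not the top row has a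
root — makes every irreducible `S ⊇` cylinder over `C ×_{x₀} F` dense (file XXXVIII for a top-row
root, this file otherwise). [cite: MantovaMasser2023, §1 Further remarks, p. 5 (the question, open
in general)] (new) -/
theorem unprojectedDense_superelliptic_fibreCurve_all {S : Set (Fin 2 ⊕ Fin 2 → ℂ)}
    (hS : IsIrreducibleClosed ℂ S) (hdim : zariskiDim ℂ S ≤ (2 : ℕ)) {k : ℕ} (hk : 3 ≤ k)
    (hP : P.Monic) (hM : 1 ≤ P.natDegree)
    (F : Polynomial (Polynomial ℂ)) (hFirr : Irreducible F) (hF1 : F.natDegree ≠ 0)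
    (hF00 : F.coeff 0 ≠ 0) (N : ℕ) (hN : ∀ j, (F.coeff j).natDegree ≤ N)
    (hsome : ∃ j, (F.coeff j).coeff N ≠ 0)
    (hsub : ∀ x₀ x₁ y₀ : ℂ, x₁ ^ k - P.eval x₀ = 0 →
      (F.map (Polynomial.evalRingHom x₀)).eval y₀ = 0 →
      (Sum.elim ![x₀, x₁] ![y₀, Complex.exp x₁] : Fin 2 ⊕ Fin 2 → ℂ) ∈ S) :
    UnprojectedDense S := by
  classical
  -- the top row as a polynomial
  set r := F.natDegree with hr
  set T : Polynomial ℂ := ∑ i ∈ Finset.range (r + 1), Polynomial.monomial i ((F.coeff i).coeff N)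
    with hT
  have hTcoeff : ∀ i, T.coeff i = (F.coeff i).coeff N := by
    intro i
    rw [hT, Polynomial.finsetSum_coeff]
    simp only [Polynomial.coeff_monomial]
    rw [Finset.sum_ite_eq']
    by_cases hi : i ∈ Finset.range (r + 1)
    · rw [if_pos hi]
    · rw [if_neg hi]
      have : F.coeff i = 0 := Polynomial.coeff_eq_zero_of_natDegree_lt (by
        rw [← hr]; rw [Finset.mem_range] at hi; omega)
      rw [this, Polynomial.coeff_zero]
  have hT0 : T ≠ 0 := by
    obtain ⟨j, hj⟩ := hsome
    intro h0
    have h := hTcoeff j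
    rw [h0, Polynomial.coeff_zero] at h
    exact hj h.symm
  by_cases hTdeg : 0 < T.degree
  · obtain ⟨θ, hθ⟩ := Complex.exists_root hTdeg
    exact unprojectedDense_superelliptic_fibreCurve P hS hdim hk hP hM F hFirr hF1 hF00 N hN T hTcoeff
      hT0 hθ hsub
  · -- `T` is a nonzero constant: its only nonzero coefficient is `T.coeff 0`, so `deg F_r < N`
    --   unless `r = 0`
    have hTc : T.natDegree = 0 := by
      have : T.degree ≤ 0 := not_lt.1 hTdeg
      exact Polynomial.natDegree_eq_zero_iff_degree_le_zero.2 this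
    have htop : (F.coeff F.natDegree).coeff N = 0 := by
      rw [← hTcoeff]
      exact Polynomial.coeff_eq_zero_of_natDegree_lt (by rw [hTc]; exact Nat.pos_of_ne_zero hF1)
    exact unprojectedDense_superelliptic_fibreCurve_poleRow P hS hdim (by omega) hP hM (Or.inr hk) F
      hFirr hF1 hF00 N hN hsome htop hsub

end Superelliptic

end Summit.Schanuel.Schanuel.Theorems

end
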